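import Summits.BirchSwinnertonDyer.BirchSwinnertonDyer.Theorems.ManinLocalTwoThreeKummerSquareCriterion
import Summits.BirchSwinnertonDyer.BirchSwinnertonDyer.Theorems.ManinLocalTwoThreeManinOddOfOddEtaExponent
import Literature.NumberTheory.EllipticCurves.FormalGroupFiniteHeightProofs
import HarnessLib

/-!
# Kummer-blindness criterion, part 2: a square Kummer class at ODD Manin constant forces a Kummer-blind root

Summit `BirchSwinnertonDyer`, route `ManinLocalTwoThree` (cell bsd-f2-manin), crux C2 `ManinOddAtFour` (stmt-BirchSwinnertonDyer-22967),
line `kato_shift_two`, v10 stub `stub_cuspidalKummerOddExponent` = E-an-53.  THE `E`-SIDE HALF of an's E-an-54 («blind ⟺ Kummer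
class trivial», MEMO-an §56.5) for ODD `c`:

`kummerBlindAtTwo_of_isTwoAdicFracSquare_of_odd` — for globally minimal elliptic `W` written with `a₁ = a₃ = 0` and integer
`a₂, a₄`, a datum `D` at a level `N` with `4 ∣ N`, integral newform coefficients, an integral root `e` of the 2-division cubic and the
formal germ `z` (`IsParamGerm`): if `c = D.c` is ODD and the Kummer series `Ξ_T` is a square in `Frac ℤ₂⟦q⟧` then `T = (e,0)` is
`KummerBlindAtTwo a₂ a₄ e`.

MECHANISM.  With `E♮ = shortModel W 1` (`2`-integral, `a₁ = a₂ = a₃ = 0`; p2's §5 of `…EvenManinKummerSquare`), `D = c·z` the germ on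
`E♮` (`log_{E♮} D = c·Σaₙqⁿ/n`; for ODD `c` the series `D ∈ qℤ₂⟦q⟧` has UNIT linear coefficient, so `q ↦ D` is inverted by Mathlib's
`substInvOfIsUnit` inside `ℤ₂⟦q⟧`), and `ε = e + a₂/3` the `2`-adic-integral abscissa on `E♮`: `Ξ = κ(D)` with `κ(t) = X(t) − εt²`,
and `κ·Q = X²` with `Q = X² + εt²X + (ε² + a₄♮)t⁴` (part 1).  So `Ξ·B² = A²` gives `Q(D)·A² = (X(D)·B)²`, hence (UFD step, p2's
`isSquare_of_mul_sq_eq_sq`) `Q(D)` and then `Q` is a square in `ℤ₂⟦t⟧`, hence (part 1, `X` even, `x₀ = 1`, `x₂ = 0`) `2 ∣ ε` and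
`16 ∣ ε² − 4(ε² + a₄♮)` in `ℤ₂`, which read `2 ∣ a₂ + e` and `16 ∣ (a₂ + e)² − 4(a₄ + (a₂ + e)e)` in `ℤ`.

Nothing about BSD or Manin's conjecture is proved here. [folklore]
-/

set_option autoImplicit false
set_option linter.dupNamespace false

noncomputable section

open scoped Classical
open PowerSeries WeierstrassCurve Literature.NumberTheory.EllipticCurves Literature.NumberTheory.EllipticCurves.ModularForms
  Literature.RingTheory.FormalGroups
open Summit.BirchSwinnertonDyer.Rank1Residual.ManinAdditive
open Summit.BirchSwinnertonDyer.Rank1Residual.ManinAdditive.CuspidalKummer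

namespace Summit.BirchSwinnertonDyer.BirchSwinnertonDyer.Theorems.ManinLocalTwoThree

/-! ### §3 The odd-`c` Kummer criterion and the converse of E-an-53's reduction -/

section Main

/-- **Kummer-blindness from a square Kummer class at ODD Manin constant** (the `E`-side half of an's E-an-54 for
odd `c`): for globally minimal elliptic `W` written with `a₁ = a₃ = 0` and integer `a₂, a₄`, a datum `D` at a level
`N` with `4 ∣ N`, integral newform coefficients `aₙ`, an integral root `e` of the 2-division cubic and the formal germ
`z` (`IsParamGerm`): if `c = D.c` is ODD and the Kummer series `Ξ_T` is a square in `Frac ℤ₂⟦q⟧`, then `T = (e, 0)` is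
`KummerBlindAtTwo`.  (Proof in the module docstring.) [folklore] -/
theorem kummerBlindAtTwo_of_isTwoAdicFracSquare_of_odd
    (W : WeierstrassCurve ℚ) [hWell : W.IsElliptic] [W.IsGloballyMinimal] {N : ℕ} [NeZero N]
    (D : ModularParametrizationData W N) (a : ℕ → ℤ) (ha : ∀ n, (a n : ℂ) = cuspCoeff D.f n)
    (h4 : 4 ∣ N) (a₂ a₄ e : ℤ) (hW₁ : W.a₁ = 0) (hW₃ : W.a₃ = 0) (hW₂ : W.a₂ = a₂) (hW₄ : W.a₄ = a₄)
    (he : W.twoTorsionPolynomial.toPoly.IsRoot (e : ℚ))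
    (z : ℚ⟦X⟧) (hz : IsParamGerm W D.c a z) (hcodd : ¬ (2 : ℤ) ∣ D.c)
    (hsq : IsTwoAdicFracSquare (kummerSeries W D.c e z)) : KummerBlindAtTwo a₂ a₄ e := by
  obtain ⟨hz0, hlog⟩ := hz
  have hc0 : D.c ≠ 0 := D.maninConstant_ne_zero_holds
  -- §5-type arithmetic at `2`
  obtain ⟨ha2, hN2⟩ := lFunction_two_eq_zero_of_four_dvd W D.isNewformOf h4
  have han : ∀ n, a n = W.LFunction n := fun n => by
    have h := ha n; rw [D.isNewformOf.2 n] at h; exact_mod_cast h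
  obtain ⟨a₆, hW₆⟩ : ∃ a₆ : ℤ, W.a₆ = a₆ := by
    refine ⟨(integralModelInt W).a₆, ?_⟩
    conv_lhs => rw [← map_integralModelInt W]
    rw [map_a₆, eq_intCast]
  -- the `2`-integral short model `E♮ = shortModel W 1`: `a₄♮ = −κ/3`, `a₆♮ = −μ/27`
  set κ : ℤ := a₂ ^ 2 - 3 * a₄ with hκ
  set μ : ℤ := -2 * a₂ ^ 3 + 9 * a₂ * a₄ - 27 * a₆ with hμ
  have hWc₄ : W.c₄ = ((16 * κ : ℤ) : ℚ) := by
    simp only [WeierstrassCurve.c₄, WeierstrassCurve.b₂, WeierstrassCurve.b₄, hW₁, hW₃, hW₂, hW₄, hκ]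
    push_cast; ring
  have hWc₆ : W.c₆ = ((32 * μ : ℤ) : ℚ) := by
    simp only [WeierstrassCurve.c₆, WeierstrassCurve.b₂, WeierstrassCurve.b₄, WeierstrassCurve.b₆, hW₁, hW₃, hW₂,
      hW₄, hW₆, hμ]
    push_cast; ring
  have hα₄ : (shortModel W 1).a₄ = -((κ : ℚ) / 3) := by
    simp only [shortModel, hWc₄]; push_cast; ring
  have hα₆ : (shortModel W 1).a₆ = -((μ : ℚ) / 27) := by
    simp only [shortModel, hWc₆]; push_cast; ring
  have h3 : ‖((3 : ℕ) : ℚ_[2])⁻¹‖ = 1 := padicTwo_norm_inv_natCast_of_odd (by decide)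
  have h27 : ‖((27 : ℕ) : ℚ_[2])⁻¹‖ = 1 := padicTwo_norm_inv_natCast_of_odd (by decide)
  have hrat : ∀ q : ℚ, algebraMap ℚ ℚ_[2] q = (q : ℚ_[2]) := fun q => by rw [eq_ratCast]
  have hA : ‖algebraMap ℚ ℚ_[2] (shortModel W 1).a₄‖ ≤ 1 := by
    rw [hrat, hα₄]; push_cast
    rw [norm_neg, div_eq_mul_inv, norm_mul, show (3 : ℚ_[2]) = ((3 : ℕ) : ℚ_[2]) by norm_cast, h3, mul_one]
    exact Padic.norm_int_le_one κ
  have hB : ‖algebraMap ℚ ℚ_[2] (shortModel W 1).a₆‖ ≤ 1 := by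
    rw [hrat, hα₆]; push_cast
    rw [norm_neg, div_eq_mul_inv, norm_mul, show (27 : ℚ_[2]) = ((27 : ℕ) : ℚ_[2]) by norm_cast, h27,
      mul_one]
    exact Padic.norm_int_le_one μ
  set A₀ : ℤ_[2] := ⟨_, hA⟩ with hA₀
  set B₀ : ℤ_[2] := ⟨_, hB⟩ with hB₀
  set V : WeierstrassCurve ℤ_[2] := ⟨0, 0, 0, A₀, B₀⟩ with hVdef
  have hVE : V.map PadicInt.Coe.ringHom = (shortModel W 1).map (algebraMap ℚ ℚ_[2]) := by
    ext <;> simp [hVdef, shortModel, hA₀, hB₀]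
  have hΔ1 : (shortModel W 1).Δ = W.Δ := by
    have hc := W.c_relation
    simp only [shortModel, WeierstrassCurve.Δ, WeierstrassCurve.b₂, WeierstrassCurve.b₄,
      WeierstrassCurve.b₆, WeierstrassCurve.b₈, Int.cast_one, one_pow, one_mul] at hc ⊢
    simp only [WeierstrassCurve.c₄, WeierstrassCurve.c₆, WeierstrassCurve.b₂, WeierstrassCurve.b₄,
      WeierstrassCurve.b₆] at hc ⊢
    linear_combination (1 / 1728 : ℚ) * hc
  haveI hEll : (V.map PadicInt.Coe.ringHom).IsElliptic := by
    rw [hVE]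
    refine ⟨?_⟩
    rw [map_Δ, hΔ1, isUnit_iff_ne_zero]
    exact (map_ne_zero _).mpr hWell.isUnit.ne_zero
  haveI hInt : (V.map PadicInt.Coe.ringHom).IsIntegral ℤ_[2] := V.isIntegral_map_coe
  -- the 2-torsion abscissa `ε = e + b₂/12 = e + a₂/3` on `E♮`, a `2`-adic integer
  set eQ : ℚ := shortRoot W 1 e with heQ
  set e₂ : ℚ_[2] := algebraMap ℚ ℚ_[2] eQ with he₂
  have heQ' : eQ = (e : ℚ) + (a₂ : ℚ) / 3 := by
    rw [heQ, shortRoot, WeierstrassCurve.b₂, hW₁, hW₂]; push_cast; ring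
  have heroot : eQ ^ 3 + (shortModel W 1).a₂ * eQ ^ 2 + (shortModel W 1).a₄ * eQ +
      (shortModel W 1).a₆ = 0 := shortRoot_one_isRoot W he
  have ha₂0 : (shortModel W 1).a₂ = 0 := rfl
  have heroot₂ : e₂ ^ 3 + (V.a₄ : ℚ_[2]) * e₂ + (V.a₆ : ℚ_[2]) = 0 := by
    have h := congrArg (algebraMap ℚ ℚ_[2]) heroot
    simp only [map_add, map_mul, map_pow, map_zero, ha₂0, zero_mul, add_zero] at h
    exact h
  have henorm : ‖e₂‖ ≤ 1 :=
    padic_norm_le_one_of_cubic_root (A := (V.a₄ : ℚ_[2])) (B := (V.a₆ : ℚ_[2]))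
      (PadicInt.norm_le_one _) (PadicInt.norm_le_one _) heroot₂
  set ε₀ : ℤ_[2] := ⟨e₂, henorm⟩ with hε₀
  have hεroot : ε₀ ^ 3 + V.a₄ * ε₀ + V.a₆ = 0 := by
    rw [← PadicInt.coe_eq_zero]
    push_cast
    exact heroot₂
  -- §C: the germ, read on `E♮ ⊗ ℚ₂`
  set ι : ℚ⟦X⟧ →+* ℚ_[2]⟦X⟧ := PowerSeries.map (algebraMap ℚ ℚ_[2]) with hι
  set z₂ : ℚ_[2]⟦X⟧ := ι z with hz₂
  set L₂ : ℚ_[2]⟦X⟧ := ι (lSeriesLog a) with hL₂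
  set D₂ : ℚ_[2]⟦X⟧ := C ((D.c : ℚ) : ℚ_[2]) * z₂ with hD₂
  have hcz0 : constantCoeff (C (D.c : ℚ) * z) = 0 := by rw [map_mul, hz0, mul_zero]
  have hlog1 : (shortModel W 1).formalLog.subst (C (D.c : ℚ) * z) = C (D.c : ℚ) * lSeriesLog a := by
    have h := formalLog_shortModel_subst W hc0 hz0
    rw [hlog] at h
    have hcc : (C (D.c : ℚ) : ℚ⟦X⟧) * C (D.c : ℚ)⁻¹ = 1 := by
      rw [← map_mul, mul_inv_cancel₀ (Int.cast_ne_zero.mpr hc0), map_one]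
    calc (shortModel W 1).formalLog.subst (C (D.c : ℚ) * z)
        = C (D.c : ℚ) * C (D.c : ℚ)⁻¹ * (shortModel W 1).formalLog.subst (C (D.c : ℚ) * z) := by
          rw [hcc, one_mul]
      _ = C (D.c : ℚ) * lSeriesLog a := by rw [mul_assoc, ← h]
  have hz₂0 : constantCoeff z₂ = 0 := by
    rw [hz₂, hι, ← coeff_zero_eq_constantCoeff, coeff_map, coeff_zero_eq_constantCoeff, hz0, map_zero]
  have hD₂0 : constantCoeff D₂ = 0 := by rw [hD₂, map_mul, hz₂0, mul_zero]
  have hL₂0 : constantCoeff L₂ = 0 := by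
    rw [hL₂, hι, ← coeff_zero_eq_constantCoeff, coeff_map, lSeriesLog, coeff_mk]; simp
  have hlog2 : (V.map PadicInt.Coe.ringHom).formalLog.subst D₂ = C ((D.c : ℚ) : ℚ_[2]) * L₂ := by
    have h := congrArg ι hlog1
    rw [hι, map_subst_apply (HasSubst.of_constantCoeff_zero' hcz0), map_formalLog, ← hVE, map_mul,
      map_C, map_mul, map_C, hrat] at h
    exact h
  -- the linear coefficient of the germ: `z = q + ⋯`, so `D₂ = c·q + ⋯`
  have hz1 : coeff 1 z = 1 := by
    have h := congrArg (coeff 1) hlog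
    rw [coeff_one_subst_eq_mul _ hz0, coeff_one_formalLog, one_mul, lSeriesLog, coeff_mk, han 1,
      W.isMultiplicative_LFunction.map_one] at h
    simpa using h
  have hD₂1 : coeff 1 D₂ = ((D.c : ℚ) : ℚ_[2]) := by
    rw [hD₂, coeff_C_mul, hz₂, hι, coeff_map, hz1, map_one, mul_one]
  -- §D: integrality of the germ (`c L₂ ∈ ℤ₂⟦q⟧`, `exp_V ∈ ℤ₂⟦T⟧`)
  have hL₂int : IsPadicInt L₂ := by
    rw [isPadicInt_iff_coeff]
    intro n
    rw [hL₂, hι, coeff_map, lSeriesLog, coeff_mk, hrat]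
    by_cases hn0 : n = 0
    · subst hn0; simp
    rcases Nat.even_or_odd n with hev | hodd
    · rw [han n, lFunction_eq_zero_of_even W ha2 hN2 hn0 (even_iff_two_dvd.mp hev)]
      simp
    · push_cast
      rw [div_eq_mul_inv, norm_mul, padicTwo_norm_inv_natCast_of_odd hodd, mul_one]
      exact Padic.norm_int_le_one _
  have hu0 : constantCoeff (C ((D.c : ℚ) : ℚ_[2]) * L₂) = 0 := by rw [map_mul, hL₂0, mul_zero]
  have hDexp : D₂ = (V.map PadicInt.Coe.ringHom).formalExp.subst (C ((D.c : ℚ) : ℚ_[2]) * L₂) := by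
    rw [← hlog2, formalExp_subst_formalLog_subst _ hD₂0]
  have hcint : IsPadicInt (C ((D.c : ℚ) : ℚ_[2]) : ℚ_[2]⟦X⟧) := by
    rw [Rat.cast_intCast]
    exact IsPadicInt.powerSeries_C (Padic.norm_int_le_one _)
  have hDint : IsPadicInt D₂ := by
    rw [hDexp]
    exact (isPadicInt_formalExp_of_a₁_a₃_two V rfl rfl).powerSeries_subst (hcint.mul hL₂int)
      (HasSubst.of_constantCoeff_zero' hu0)
  obtain ⟨Dz, hDz⟩ := isPadicInt_iff_exists_powerSeries_map.mp hDint
  have hκinj : Function.Injective (PowerSeries.map (PadicInt.Coe.ringHom (p := 2))) :=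
    PowerSeries.map_injective _ (fun x y h => PadicInt.ext h)
  have hDz0 : constantCoeff Dz = 0 := by
    have h : (PadicInt.Coe.ringHom (p := 2)) (constantCoeff Dz) = 0 := by
      rw [← coeff_zero_eq_constantCoeff_apply, ← coeff_map, hDz, coeff_zero_eq_constantCoeff_apply, hD₂0]
    exact PadicInt.coe_eq_zero.mp h
  have hDz1 : IsUnit (coeff 1 Dz) := by
    have h : ((coeff 1 Dz : ℤ_[2]) : ℚ_[2]) = ((D.c : ℤ) : ℚ_[2]) := by
      have h' : (PadicInt.Coe.ringHom (p := 2)) (coeff 1 Dz) = coeff 1 D₂ := by rw [← coeff_map, hDz]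
      rw [hD₂1, Rat.cast_intCast] at h'
      exact h'
    rw [PadicInt.isUnit_iff, PadicInt.norm_def, h]
    have hle : ‖((D.c : ℤ) : ℚ_[2])‖ ≤ 1 := Padic.norm_int_le_one _
    have hnlt : ¬ ‖((D.c : ℤ) : ℚ_[2])‖ < 1 := by
      rw [Padic.norm_intCast_lt_one_iff]; exact_mod_cast hcodd
    exact le_antisymm hle (not_lt.mp hnlt)
  have hsDz : HasSubst Dz := HasSubst.of_constantCoeff_zero' hDz0
  set I : ℤ_[2]⟦X⟧ := substInvOfIsUnit Dz hDz1 with hI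
  have hsI : HasSubst I := HasSubst.substInvOfIsUnit Dz hDz1
  have hDI : Dz.subst I = X := subst_substInvOfIsUnit_right Dz hDz0 hDz1
  -- §E: the Kummer series on `E♮ ⊗ ℚ₂` and the chart identity composed with the germ
  have hΞ : ι (kummerSeries W D.c e z) =
      (V.map PadicInt.Coe.ringHom).formalXMulSq.subst D₂ - C e₂ * D₂ ^ 2 := by
    have h1 : ι ((shortModel W D.c).formalXMulSq.subst z) =
        (V.map PadicInt.Coe.ringHom).formalXMulSq.subst D₂ := by
      rw [formalXMulSq_shortModel_subst W hc0 hz0, hι,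
        map_subst_apply (HasSubst.of_constantCoeff_zero' hcz0), map_formalXMulSq, ← hVE, map_mul, map_C,
        hrat]
    have h2 : ι (shortRoot W D.c e • z ^ 2) = C e₂ * D₂ ^ 2 := by
      have hsc : algebraMap ℚ ℚ_[2] (shortRoot W D.c e) = e₂ * ((D.c : ℚ) : ℚ_[2]) ^ 2 := by
        rw [he₂, heQ, hrat, hrat]
        simp only [shortRoot]
        push_cast
        ring
      rw [smul_eq_C_mul, map_mul, map_pow, hι, map_C, hsc, hD₂]
      simp only [map_mul, map_pow]
      ring
    rw [kummerSeries, map_sub, h1, h2]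
  set XV : ℤ_[2]⟦X⟧ := V.formalXMulSq with hXV
  set QV : ℤ_[2]⟦X⟧ := XV ^ 2 + C ε₀ * X ^ 2 * XV + C (ε₀ ^ 2 + V.a₄) * X ^ 4 with hQV
  have hchart : (XV - C ε₀ * X ^ 2) * QV = XV ^ 2 :=
    formalXMulSq_sub_mul_quadratic_eq_sq V rfl rfl rfl hεroot
  -- read `κ(Dz) = Ξ`, all in `ℤ₂⟦q⟧` after mapping
  have hsD₂ : HasSubst D₂ := HasSubst.of_constantCoeff_zero' hD₂0
  have hκD : PowerSeries.map PadicInt.Coe.ringHom ((XV - C ε₀ * X ^ 2).subst Dz) =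
      ι (kummerSeries W D.c e z) := by
    rw [hΞ, map_subst_apply hsDz, hDz, map_sub, subst_sub hsD₂, hXV, map_formalXMulSq, map_mul, map_C, map_pow,
      map_X, subst_mul hsD₂, subst_pow hsD₂, Literature.NumberTheory.EllipticCurves.C_subst, subst_X hsD₂]
    rfl
  -- the 2-adic square: `Ξ·B'² = A'²`
  obtain ⟨A, B, hBne, hAB⟩ := hsq
  rw [Subsingleton.elim (Rat.castHom ℚ_[2]) (algebraMap ℚ ℚ_[2])] at hAB
  change ι (kummerSeries W D.c e z) * PowerSeries.map PadicInt.Coe.ringHom B ^ 2 =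
    PowerSeries.map PadicInt.Coe.ringHom A ^ 2 at hAB
  -- `Q(Dz)·A² = (X(Dz)·B)²` in `ℤ₂⟦q⟧`
  have hQA : QV.subst Dz * A ^ 2 = (XV.subst Dz * B) ^ 2 := by
    apply hκinj
    have hch : PowerSeries.map PadicInt.Coe.ringHom (((XV - C ε₀ * X ^ 2) * QV).subst Dz) =
        PowerSeries.map PadicInt.Coe.ringHom ((XV ^ 2).subst Dz) := by rw [hchart]
    rw [subst_mul hsDz, map_mul, hκD, subst_pow hsDz, map_pow] at hch
    simp only [map_mul, map_pow, mul_pow]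
    -- hch : ιΞ * map (QV.subst Dz) = map (XV.subst Dz) ^ 2
    linear_combination PowerSeries.map PadicInt.Coe.ringHom B ^ 2 * hch -
      PowerSeries.map PadicInt.Coe.ringHom (QV.subst Dz) * hAB
  -- `A ≠ 0`: `Ξ(0) = 1` and `B ≠ 0`
  have hΞ0 : constantCoeff (kummerSeries W D.c e z) = 1 := by
    rw [kummerSeries, map_sub,
      Literature.RingTheory.FormalGroups.constantCoeff_subst_of_constantCoeff_eq_zero hz0,
      constantCoeff_formalXMulSq, smul_eq_C_mul, map_mul, map_pow, hz0]
    simp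
  have hAne : A ≠ 0 := by
    intro hA0
    rw [hA0, map_zero, zero_pow two_ne_zero] at hAB
    rcases mul_eq_zero.mp hAB with h | h
    · have h' := congrArg constantCoeff h
      rw [hι, ← coeff_zero_eq_constantCoeff, coeff_map, coeff_zero_eq_constantCoeff, hΞ0, map_one,
        map_zero] at h'
      exact one_ne_zero h'
    · exact hBne (hκinj (by rw [map_zero]; exact (pow_eq_zero_iff two_ne_zero).mp h))
  -- UFD step: `Q(Dz)` is a square in `ℤ₂⟦q⟧`; invert the germ: `Q` is a square in `ℤ₂⟦t⟧`
  have hsqQD : IsSquare (QV.subst Dz) := isSquare_of_mul_sq_eq_sq hAne hQA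
  have hsqQ : IsSquare QV := by
    obtain ⟨G, hG⟩ := hsqQD
    refine ⟨PowerSeries.subst I G, ?_⟩
    have h : PowerSeries.subst I (QV.subst Dz) = PowerSeries.subst I (G * G) := by rw [hG]
    rw [PowerSeries.subst_comp_subst_apply hsDz hsI, hDI, X_subst, subst_mul hsI] at h
    exact h
  -- §F: the coefficient lemma
  haveI : V.IsCharNeTwoNF := ⟨rfl, rfl⟩
  have hx0 : coeff 0 XV = 1 := by rw [coeff_zero_eq_constantCoeff]; exact V.constantCoeff_formalXMulSq
  have hx2 : coeff 2 XV = 0 := coeff_two_formalXMulSq_eq_zero V rfl rfl rfl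
  have hxodd : ∀ n, Odd n → coeff n XV = 0 := fun n hn => V.coeff_formalXMulSq_eq_zero_of_odd hn
  obtain ⟨h2ε, h16⟩ := two_dvd_and_sixteen_dvd_of_isSquare hx0 hx2 hxodd ε₀ (ε₀ ^ 2 + V.a₄) hsqQ
  -- §G: back to the integers `b = a₂ + e`, `b² − 4c'`
  have hε₀Q : (ε₀ : ℚ_[2]) = ((e : ℚ) : ℚ_[2]) + ((a₂ : ℚ) : ℚ_[2]) / 3 := by
    change e₂ = _
    rw [he₂, heQ', hrat]; push_cast; ring
  have hA₀Q : (V.a₄ : ℚ_[2]) = ((a₄ : ℚ) : ℚ_[2]) - ((a₂ : ℚ) : ℚ_[2]) ^ 2 / 3 := by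
    change ((A₀ : ℤ_[2]) : ℚ_[2]) = _
    rw [hA₀]
    change algebraMap ℚ ℚ_[2] (shortModel W 1).a₄ = _
    rw [hrat, hα₄, hκ]; push_cast; ring
  have h3u : ‖((3 : ℚ_[2]))⁻¹‖ = 1 := by exact_mod_cast h3
  have h2c : ((2 : ℤ_[2]) : ℚ_[2]) = 2 := by exact_mod_cast (PadicInt.coe_natCast (p := 2) 2)
  have h4c : ((4 : ℤ_[2]) : ℚ_[2]) = 4 := by exact_mod_cast (PadicInt.coe_natCast (p := 2) 4)
  have h16c : ((16 : ℤ_[2]) : ℚ_[2]) = 16 := by exact_mod_cast (PadicInt.coe_natCast (p := 2) 16)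
  constructor
  · -- `2 ∣ a₂ + e`
    obtain ⟨m, hm⟩ := h2ε
    have hmQ : ((a₂ + e : ℤ) : ℚ_[2]) = 2 * ((m : ℚ_[2]) + ((a₂ : ℚ) : ℚ_[2]) / 3) := by
      have h := congrArg (fun x : ℤ_[2] => (x : ℚ_[2])) hm
      simp only [PadicInt.coe_mul] at h
      rw [hε₀Q, h2c] at h
      push_cast at h ⊢
      linear_combination h
    have hlt : ‖((a₂ + e : ℤ) : ℚ_[2])‖ < 1 := by
      rw [hmQ, norm_mul]
      have h2n : ‖(2 : ℚ_[2])‖ < 1 := by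
        have := Padic.norm_p_lt_one (p := 2); exact_mod_cast this
      have hmn : ‖(m : ℚ_[2]) + ((a₂ : ℚ) : ℚ_[2]) / 3‖ ≤ 1 := by
        refine (Padic.nonarchimedean _ _).trans (max_le (PadicInt.norm_le_one _) ?_)
        push_cast
        rw [div_eq_mul_inv, norm_mul, h3u, mul_one]
        exact Padic.norm_int_le_one _
      calc ‖(2 : ℚ_[2])‖ * ‖(m : ℚ_[2]) + ((a₂ : ℚ) : ℚ_[2]) / 3‖ ≤ ‖(2 : ℚ_[2])‖ * 1 := by gcongr
        _ < 1 := by rw [mul_one]; exact h2n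
    have hdvd : (2 : ℤ) ∣ a₂ + e := by
      have := (Padic.norm_intCast_lt_one_iff (p := 2)).mp hlt; exact_mod_cast this
    exact even_iff_two_dvd.mpr hdvd
  · -- `16 ∣ (a₂ + e)² − 4(a₄ + (a₂ + e)e)`
    obtain ⟨m, hm⟩ := h16
    have hmQ : (((a₂ + e) ^ 2 - 4 * (a₄ + (a₂ + e) * e) : ℤ) : ℚ_[2]) = 16 * (m : ℚ_[2]) := by
      have h := congrArg (fun x : ℤ_[2] => (x : ℚ_[2])) hm
      simp only [PadicInt.coe_mul, PadicInt.coe_sub, PadicInt.coe_pow, PadicInt.coe_add] at h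
      rw [hε₀Q, hA₀Q, h4c, h16c] at h
      push_cast at h ⊢
      linear_combination h
    have hle : ‖(((a₂ + e) ^ 2 - 4 * (a₄ + (a₂ + e) * e) : ℤ) : ℚ_[2])‖ ≤ (2 : ℝ) ^ (-(4 : ℤ)) := by
      rw [hmQ, norm_mul]
      have h16n : ‖(16 : ℚ_[2])‖ = (2 : ℝ) ^ (-(4 : ℤ)) := by
        rw [show (16 : ℚ_[2]) = ((2 : ℕ) : ℚ_[2]) ^ 4 by norm_num, norm_pow, Padic.norm_p]
        norm_num
      rw [h16n]
      calc (2 : ℝ) ^ (-(4 : ℤ)) * ‖(m : ℚ_[2])‖ ≤ (2 : ℝ) ^ (-(4 : ℤ)) * 1 := by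
            gcongr; exact PadicInt.norm_le_one _
        _ = (2 : ℝ) ^ (-(4 : ℤ)) := mul_one _
    have hdvd := (Padic.norm_int_le_pow_iff_dvd _ 4).mp (by exact_mod_cast hle)
    exact_mod_cast hdvd

end Main

end Summit.BirchSwinnertonDyer.BirchSwinnertonDyer.Theorems.ManinLocalTwoThree

end
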